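/-
COR-CM (cell pub-hodgecm2, stage 2 of the Hodge ladder) — count-neutral KERNEL COMBINATORICS «base change and quotient passage for the
ENLARGED generating module (faces + known products)» (seat prover-pub-hodgecm2-b09-g21-0, binder prover b09, gen 21; own lane
DECIC-MARKMAN-TRANSPORT; sequel of `CorCM/FacePeriodsKnownProducts.lean` p298826 and of seat b23's `CorCM/FaceCensusOrbitTransport.lean`
§1 / `CorCM/FaceCharacterSaturation.lean`, consumed BY NAME).  Theorems only; no geometry, no `Universe`, no definition, no named
fact, nothing asserted; `Interfaces.lean` (C1), every E term, `B01/*`, `Transposition/*` untouched.  HONEST FRAMING: `HC_CM` is NOT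
proved; nothing here concerns any particular field.  T5: no hypothesis binder of Prop sort besides module memberships; n/a.
-/
import Summits.HodgeConjecture.CorCM.FaceCensusOrbitTransport
import HarnessLib

/-!
# The enlarged generating module (face corner indicators + Hodge-weight relations of known products): base change, quotient

The binder of the enlarged face transport (`Universe.hc_cmProd_of_faceSet_of_known`, `CorCM/FacePeriodsKnownProducts.lean`) asks, for
every face `f`, that `lefChar f.corner (· ↦ {σ₀})` lie in the subgroup of `Asym F` generated by the Weil characters of the faces of
`𝒮` (all base embeddings) and the Lefschetz characters `lefChar Θ′ S′` of the Hodge weights `S′` of the families `Θ′ ∈ 𝒲`.  As in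
seat b23's face-only transport, such memberships are certified PRE-QUOTIENT, in `ℤ[types]`, as
`weightRel f.corner (· ↦ {σ₀}) ∈ span ℤ Y(𝒮, 𝒲) ⊔ pairRel` with
`Y(𝒮, 𝒲) = {weightRel g.corner (· ↦ {σ}) | g ∈ 𝒮, σ} ∪ {weightRel Θ′ S′ | Θ′ ∈ 𝒲, S′ a Hodge weight}`.  This file supplies the
two generic tools for that currency:

* §1 BASE CHANGE: `Finsupp.mapDomain (Ψ ↦ Ψ·Q⁻¹)` maps `weightRel Θ S` to `weightRel Θ (Q • S)` (`mapDomain_weightRel`), and a Galois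
  translate of a Hodge weight is a Hodge weight (`isHodgeWeight_map`), so `span ℤ Y(𝒮, 𝒲) ⊔ pairRel` is stable
  under base change (`mapDomain_mem_span_known`) and a membership certified at ONE base embedding holds at all of them
  (`weightRel_corner_mem_span_known_baseChange`) — b23's `FaceCensus.mapDomain_mem_of_mem` / `weightRel_mem_baseChange` with the
  known-product generators added;
* §2 QUOTIENT: `ā` is additive and kills `pairRel`, so `weightRel Θ S ∈ span ℤ Y(𝒮, 𝒲) ⊔ pairRel` gives
  `lefChar Θ S ∈ AddSubgroup.closure (ā Y(𝒮, 𝒲))` — the generating set of `FacePeriodsKnownProducts.lean` verbatim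
  (`lefChar_mem_closure_known_of_weightRel_mem`; b23's `hgen_of_weightRel_mem_span` with the known-product generators added).

References: [QW8] Def. 2.3; [cite: Pohlmann1968, Thm. 1]; [cite: Milne1999LefschetzClasses, Thm. 3.2].
-/

noncomputable section

open NumberField NumberField.ComplexEmbedding

namespace Summit.HodgeConjecture.CorCM.FaceCensus

open Literature.AlgebraicGeometry.Motives (CMType)
open Literature.NumberTheory.ComplexMultiplication.CMTypeOps
open Summit.HodgeConjecture.CorCM.Prior.AllgGroup.RfwfAllgGroup

variable {F : Type} [Field F] [NumberField F] [IsGalois ℚ F]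

/-! ## §1 Base change of the enlarged generating module -/

omit [IsGalois ℚ F] in
/-- **A Galois translate of a Hodge weight is a Hodge weight** (the `F : Type` form of `Universe.isHodgeWeight_permWeight`; the
translated weight is `(Q • S)_j = Q(S_j)`). [folklore] -/
theorem isHodgeWeight_map (Q : GalT F) {m : ℕ} {Θ : Fin (m + 1) → CMType F} {p : ℕ}
    {S : Fin (m + 1) → Finset (F →+* ℂ)} (hS : IsHodgeWeight Θ p S) :
    IsHodgeWeight Θ p (fun j => (S j).map Q.1.toEmbedding) := by
  refine ⟨by simp only [Finset.card_map]; exact hS.1, fun P => ?_⟩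
  simp only [Finset.sum_map, Equiv.toEmbedding_apply]
  have h := hS.2 (P * Q)
  simpa only [GalT.mul_apply] using h

/-- **Base change of a weight relation**: mapping every abstract type along `Q` sends `weightRel Θ S` to the weight relation of the
translated weight `Q • S`. [folklore] -/
theorem mapDomain_weightRel (σ₀ : F →+* ℂ) (Q : GalT F) {m : ℕ} (Θ : Fin (m + 1) → CMType F)
    (S : Fin (m + 1) → Finset (F →+* ℂ)) :
    Finsupp.mapDomain (fun Ψ => pullType (pushType σ₀ Ψ) (Q.1 σ₀)) (weightRel Θ S) =
      weightRel Θ (fun j => (S j).map Q.1.toEmbedding) := by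
  unfold weightRel
  simp only [Finsupp.mapDomain_finsetSum, Finsupp.mapDomain_single, pullType_pushType_pullType, Finset.sum_map,
    Equiv.toEmbedding_apply]

/-- **The enlarged generating module is stable under base change** (faces: b23's `mapDomain_weightRel_corner`; known products:
`mapDomain_weightRel` + `isHodgeWeight_map`; pairs: `pullType_pushType_barCM`). [folklore] -/
theorem mapDomain_mem_span_known (σ₀ : F →+* ℂ) (Q : GalT F) (𝒮 : Set (Face F))
    (𝒲 : Set ((m : ℕ) × (Fin (m + 1) → CMType F))) {x : CMF (GalT F) conjT →₀ ℤ}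
    (hx : x ∈ Submodule.span ℤ {y : CMF (GalT F) conjT →₀ ℤ |
        (∃ g ∈ 𝒮, ∃ σ : F →+* ℂ, y = weightRel g.corner (fun _ => ({σ} : Finset (F →+* ℂ)))) ∨
        ∃ w ∈ 𝒲, ∃ (p' : ℕ) (S' : Fin (w.1 + 1) → Finset (F →+* ℂ)), IsHodgeWeight w.2 p' S' ∧ y = weightRel w.2 S'}
        ⊔ pairRel) :
    Finsupp.mapDomain (fun Ψ => pullType (pushType σ₀ Ψ) (Q.1 σ₀)) x ∈
      Submodule.span ℤ {y : CMF (GalT F) conjT →₀ ℤ |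
        (∃ g ∈ 𝒮, ∃ σ : F →+* ℂ, y = weightRel g.corner (fun _ => ({σ} : Finset (F →+* ℂ)))) ∨
        ∃ w ∈ 𝒲, ∃ (p' : ℕ) (S' : Fin (w.1 + 1) → Finset (F →+* ℂ)), IsHodgeWeight w.2 p' S' ∧ y = weightRel w.2 S'}
        ⊔ pairRel := by
  obtain ⟨y, hy, z, hz, rfl⟩ := Submodule.mem_sup.mp hx
  rw [Finsupp.mapDomain_add]
  refine Submodule.add_mem _ (Submodule.mem_sup_left ?_) (Submodule.mem_sup_right ?_)
  · refine Submodule.span_induction (p := fun y _ => Finsupp.mapDomain (fun Ψ => pullType (pushType σ₀ Ψ) (Q.1 σ₀)) y ∈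
        Submodule.span ℤ {y : CMF (GalT F) conjT →₀ ℤ |
          (∃ g ∈ 𝒮, ∃ σ : F →+* ℂ, y = weightRel g.corner (fun _ => ({σ} : Finset (F →+* ℂ)))) ∨
          ∃ w ∈ 𝒲, ∃ (p' : ℕ) (S' : Fin (w.1 + 1) → Finset (F →+* ℂ)), IsHodgeWeight w.2 p' S' ∧ y = weightRel w.2 S'})
      ?_ ?_ ?_ ?_ hy
    · rintro _ (⟨g, hg, σ, rfl⟩ | ⟨w, hw, p', S', hS', rfl⟩)
      · rw [mapDomain_weightRel_corner]
        exact Submodule.subset_span (Or.inl ⟨g, hg, Q.1 σ, rfl⟩)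
      · rw [mapDomain_weightRel]
        exact Submodule.subset_span (Or.inr ⟨w, hw, p', _, isHodgeWeight_map Q hS', rfl⟩)
    · rw [Finsupp.mapDomain_zero]; exact Submodule.zero_mem _
    · intro a b _ _ ha hb; rw [Finsupp.mapDomain_add]; exact Submodule.add_mem _ ha hb
    · intro n a _ ha; rw [Finsupp.mapDomain_smul]; exact Submodule.smul_mem _ n ha
  · refine Submodule.span_induction (p := fun z _ => Finsupp.mapDomain (fun Ψ => pullType (pushType σ₀ Ψ) (Q.1 σ₀)) z ∈
        (pairRel : Submodule ℤ (CMF (GalT F) conjT →₀ ℤ))) ?_ ?_ ?_ ?_ hz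
    · rintro _ ⟨Ψ, rfl⟩
      rw [Finsupp.mapDomain_add, Finsupp.mapDomain_single, Finsupp.mapDomain_single, pullType_pushType_barCM]
      exact Submodule.subset_span ⟨_, rfl⟩
    · rw [Finsupp.mapDomain_zero]; exact Submodule.zero_mem _
    · intro a b _ _ ha hb; rw [Finsupp.mapDomain_add]; exact Submodule.add_mem _ ha hb
    · intro n a _ ha; rw [Finsupp.mapDomain_smul]; exact Submodule.smul_mem _ n ha

/-- **Membership at one base embedding gives membership at every base embedding** (enlarged module). [folklore] -/
theorem weightRel_corner_mem_span_known_baseChange (𝒮 : Set (Face F)) (𝒲 : Set ((m : ℕ) × (Fin (m + 1) → CMType F)))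
    (f : Face F) (σ σ' : F →+* ℂ)
    (h : weightRel f.corner (fun _ => ({σ} : Finset (F →+* ℂ))) ∈
      Submodule.span ℤ {y : CMF (GalT F) conjT →₀ ℤ |
        (∃ g ∈ 𝒮, ∃ σ : F →+* ℂ, y = weightRel g.corner (fun _ => ({σ} : Finset (F →+* ℂ)))) ∨
        ∃ w ∈ 𝒲, ∃ (p' : ℕ) (S' : Fin (w.1 + 1) → Finset (F →+* ℂ)), IsHodgeWeight w.2 p' S' ∧ y = weightRel w.2 S'}
        ⊔ pairRel) :
    weightRel f.corner (fun _ => ({σ'} : Finset (F →+* ℂ))) ∈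
      Submodule.span ℤ {y : CMF (GalT F) conjT →₀ ℤ |
        (∃ g ∈ 𝒮, ∃ σ : F →+* ℂ, y = weightRel g.corner (fun _ => ({σ} : Finset (F →+* ℂ)))) ∨
        ∃ w ∈ 𝒲, ∃ (p' : ℕ) (S' : Fin (w.1 + 1) → Finset (F →+* ℂ)), IsHodgeWeight w.2 p' S' ∧ y = weightRel w.2 S'}
        ⊔ pairRel := by
  have e : (translate σ σ').1 σ = σ' := translate_apply_self σ σ'
  rw [← e, ← mapDomain_weightRel_corner σ (translate σ σ') f σ]
  exact mapDomain_mem_span_known σ _ 𝒮 𝒲 h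

/-! ## §2 Passage to the quotient `Asym F` -/

omit [IsGalois ℚ F] in
/-- **From the pre-quotient certificate to the binder's currency**: `ā` is additive and kills `pairRel`, and
`ā (weightRel Θ S) = lefChar Θ S` (`abar_weightRel`), so membership of `weightRel Θ S` in the enlarged module gives membership of
`lefChar Θ S` in the subgroup of `Asym F` generated by the Weil characters of the faces of `𝒮` and the Hodge-weight characters of
the families of `𝒲` — the generating set of `Universe.hc_cmProd_of_faceSet_of_known` verbatim. [cite: Pohlmann1968, Thm. 1]
[cite: Milne1999LefschetzClasses, Thm. 3.2] -/
theorem lefChar_mem_closure_known_of_weightRel_mem (𝒮 : Set (Face F)) (𝒲 : Set ((m : ℕ) × (Fin (m + 1) → CMType F)))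
    {m : ℕ} (Θ : Fin (m + 1) → CMType F) (S : Fin (m + 1) → Finset (F →+* ℂ))
    (h : weightRel Θ S ∈
      Submodule.span ℤ {y : CMF (GalT F) conjT →₀ ℤ |
        (∃ g ∈ 𝒮, ∃ σ : F →+* ℂ, y = weightRel g.corner (fun _ => ({σ} : Finset (F →+* ℂ)))) ∨
        ∃ w ∈ 𝒲, ∃ (p' : ℕ) (S' : Fin (w.1 + 1) → Finset (F →+* ℂ)), IsHodgeWeight w.2 p' S' ∧ y = weightRel w.2 S'}
        ⊔ pairRel) :
    lefChar Θ S ∈ AddSubgroup.closure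
      {a : Asym F | (∃ g ∈ 𝒮, ∃ σ : F →+* ℂ, a = lefChar g.corner (fun _ => ({σ} : Finset (F →+* ℂ)))) ∨
        ∃ w ∈ 𝒲, ∃ (p' : ℕ) (S' : Fin (w.1 + 1) → Finset (F →+* ℂ)), IsHodgeWeight w.2 p' S' ∧ a = lefChar w.2 S'} := by
  rw [← abar_weightRel]
  obtain ⟨y, hy, z, hz, hyz⟩ := Submodule.mem_sup.mp h
  have hz0 : abar z = 0 := (Submodule.Quotient.mk_eq_zero _).mpr hz
  rw [← hyz, map_add, hz0, add_zero]
  refine Submodule.span_induction (p := fun y _ => abar y ∈ AddSubgroup.closure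
      {a : Asym F | (∃ g ∈ 𝒮, ∃ σ : F →+* ℂ, a = lefChar g.corner (fun _ => ({σ} : Finset (F →+* ℂ)))) ∨
        ∃ w ∈ 𝒲, ∃ (p' : ℕ) (S' : Fin (w.1 + 1) → Finset (F →+* ℂ)), IsHodgeWeight w.2 p' S' ∧ a = lefChar w.2 S'})
    ?_ ?_ ?_ ?_ hy
  · rintro _ (⟨g, hg, σ, rfl⟩ | ⟨w, hw, p', S', hS', rfl⟩)
    · rw [abar_weightRel]
      exact AddSubgroup.subset_closure (Or.inl ⟨g, hg, σ, rfl⟩)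
    · rw [abar_weightRel]
      exact AddSubgroup.subset_closure (Or.inr ⟨w, hw, p', S', hS', rfl⟩)
  · rw [map_zero]
    exact AddSubgroup.zero_mem _
  · intro a b _ _ ha hb
    rw [map_add]
    exact AddSubgroup.add_mem _ ha hb
  · intro n a _ ha
    rw [map_zsmul]
    exact AddSubgroup.zsmul_mem _ ha n

/-- **Corollary (the form the decic file uses)**: a corner indicator certified at ONE base embedding lies, at EVERY base embedding,
in the subgroup generated by the enlarged generating set. [cite: Pohlmann1968, Thm. 1] -/
theorem lefChar_corner_mem_closure_known_of_weightRel_mem (𝒮 : Set (Face F))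
    (𝒲 : Set ((m : ℕ) × (Fin (m + 1) → CMType F))) (f : Face F) (σ₀ : F →+* ℂ)
    (h : weightRel f.corner (fun _ => ({σ₀} : Finset (F →+* ℂ))) ∈
      Submodule.span ℤ {y : CMF (GalT F) conjT →₀ ℤ |
        (∃ g ∈ 𝒮, ∃ σ : F →+* ℂ, y = weightRel g.corner (fun _ => ({σ} : Finset (F →+* ℂ)))) ∨
        ∃ w ∈ 𝒲, ∃ (p' : ℕ) (S' : Fin (w.1 + 1) → Finset (F →+* ℂ)), IsHodgeWeight w.2 p' S' ∧ y = weightRel w.2 S'}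
        ⊔ pairRel) (σ : F →+* ℂ) :
    lefChar f.corner (fun _ => ({σ} : Finset (F →+* ℂ))) ∈ AddSubgroup.closure
      {a : Asym F | (∃ g ∈ 𝒮, ∃ σ : F →+* ℂ, a = lefChar g.corner (fun _ => ({σ} : Finset (F →+* ℂ)))) ∨
        ∃ w ∈ 𝒲, ∃ (p' : ℕ) (S' : Fin (w.1 + 1) → Finset (F →+* ℂ)), IsHodgeWeight w.2 p' S' ∧ a = lefChar w.2 S'} :=
  lefChar_mem_closure_known_of_weightRel_mem 𝒮 𝒲 f.corner _
    (weightRel_corner_mem_span_known_baseChange 𝒮 𝒲 f σ₀ σ h)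

end Summit.HodgeConjecture.CorCM.FaceCensus

end
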